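import Summits.PneNP.PneNP.Theorems.ConvexRankGatesCliqueExtLowerBoundCnfSide
import Summits.PneNP.PneNP.Theorems.ConvexRankGatesCliqueExtLowerBoundGRankPrimeField

/-!
# Route ConvexRankGates, crux `CliqueExtLowerBound` (stmt-PneNP-10682): the GRANK leaf over the concrete fields `𝔽̄_p`

Support file (`--supports stmt-PneNP-10682`, registered sub-goal `grankCnf_iff_primeFieldLeaf` of the line
`width-threshold-certificate-sparsity`, lead c11). The registered GRANK leaf `stub_grankCnf` (skeleton r7) quantifies
over an abstract gate `φ : GateFn` with `IsGRankGate (m^c) φ`, i.e. over `∃ (F : Type) [Field F]` and data over `F`.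
By the field normal form `GRankPrimeField.isGRankGate_iff_algClosure_zmod` (p148712) the leaf is EQUIVALENT to a fully
concrete statement with no type-valued quantifier and no abstract gate: for every prime `p`, all `d ≤ m^c`, `θ`, and all
matrices `K₀, Kᵢ ∈ 𝔽̄_p^{d×d}` (`𝔽̄_p = AlgebraicClosure (ZMod p)`), the rank-threshold gate
`v ↦ [θ ≤ rank (K₀ + ∑_{vᵢ=1} Xᵢ Kᵢ)]` composed with `s`-local monotone CNFs of the edges admits the legal local
sandwich (`grankCnf_iff_primeFieldLeaf`). This is the form in which a refuter picks ONE prime and ONE matrix pencil, and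
in which the planner may file the GRANK child of the prepared split (`Cruxes/CliqueExtLowerBound/SPLIT-PROPOSAL-r7.md`).
Generic ingredient: `forall_isGRankGate_iff` (a `∀ φ, IsGRankGate s φ → Q φ` ranges exactly over the explicit
`𝔽̄_p`-gates `⟨n, v ↦ decide (θ ≤ rank …)⟩`). No new definitions. [folklore]
-/

-- `Summit.PneNP.PneNP.…` duplicates `PneNP` BY DESIGN (single-problem summit).
set_option linter.dupNamespace false

open Literature.Computability.Complexity Filter Finset
open Summit.PneNP.PneNP.Theorems.CliqueExtLowerBound.WidthThreshold
open Summit.PneNP.PneNP.Theorems.CliqueExtLowerBound.GRankPrimeField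

noncomputable section

namespace Summit.PneNP.PneNP.Theorems.CliqueExtLowerBound.GRankPrimeFieldLeaf

/-- **Quantifying over GRANK gates = quantifying over explicit `𝔽̄_p` rank-threshold gates.** For any property `Q`
of gate functions, `Q` holds for every GRANK gate of size parameter `s` iff it holds for every gate
`⟨n, v ↦ decide (θ ≤ rank (K₀ + ∑_{vᵢ=1} Xᵢ Kᵢ))⟩` with `p` prime, `d ≤ s`, `K₀, Kᵢ` over `AlgebraicClosure (ZMod p)`.
[folklore] -/
theorem forall_isGRankGate_iff {s : ℕ} {Q : GateFn → Prop} :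
    (∀ φ : GateFn, IsGRankGate s φ → Q φ) ↔
      ∀ (p : ℕ) (_ : Fact p.Prime) (n d θ : ℕ), d ≤ s →
        ∀ (K₀ : Matrix (Fin d) (Fin d) (AlgebraicClosure (ZMod p)))
          (K : Fin n → Matrix (Fin d) (Fin d) (AlgebraicClosure (ZMod p))),
          Q ⟨n, fun v => decide (θ ≤ (symbolicMatrix K₀ K v).rank)⟩ := by
  constructor
  · intro h p _ n d θ hd K₀ K
    refine h _ (isGRankGate_iff_algClosure_zmod.2 ⟨p, inferInstance, d, θ, hd, K₀, K, fun v => ?_⟩)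
    exact decide_eq_true_iff
  · rintro h ⟨n, f⟩ hφ
    obtain ⟨p, _, d, θ, hd, K₀, K, hf⟩ := isGRankGate_iff_algClosure_zmod.1 hφ
    dsimp only at K hf
    have hfeq : f = fun v => decide (θ ≤ (symbolicMatrix K₀ K v).rank) := by
      funext v
      rw [Bool.eq_iff_iff, hf v]
      exact decide_eq_true_iff.symm
    rw [hfeq]
    exact h p inferInstance n d θ hd K₀ K

open Classical in
/-- Registered sub-goal `grankCnf_iff_primeFieldLeaf` (lead c11): **the r7 GRANK leaf `stub_grankCnf` is equivalent
to its concrete `𝔽̄_p` form** — the same local-sandwich conclusion for the explicit rank-threshold gate of every matrix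
pencil `K₀ + ∑ Xᵢ Kᵢ` over `AlgebraicClosure (ZMod p)`, `p` prime, `d ≤ m^c` (no `∃ (F : Type)`, no abstract `φ`).
[folklore] -/
theorem grankCnf_iff_primeFieldLeaf :
    (∀ c : ℕ, ∃ r₀ s₀ : ℕ, 2 ≤ r₀ ∧ 2 ≤ s₀ ∧ ∀ r s : ℕ, r₀ ≤ r → s₀ ≤ s →
    ∀ᶠ m : ℕ in atTop, ∀ φ : GateFn, IsGRankGate (m ^ c) φ →
      ¬ (IsPermGate ⌊(m : ℝ) ^ (1 / 16 : ℝ)⌋₊ φ ∨ IsGRankGate ⌊(m : ℝ) ^ (1 / 16 : ℝ)⌋₊ φ) →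
      ∀ C : Fin φ.1 → Finset (Finset ((⊤ : SimpleGraph (Fin m)).edgeSet)),
        #(univ.image C) ≤ m ^ (c + 3) → (∀ j, ∀ S ∈ C j, #S ≤ s - 1) →
        ∃ dnf cnf : Finset (Finset ((⊤ : SimpleGraph (Fin m)).edgeSet)),
          (∀ R ∈ dnf, #R ≤ r - 1) ∧ (∀ S ∈ cnf, #S ≤ s - 1) ∧
          (∀ x, EvalDNF dnf x → EvalCNF cnf x) ∧
          (#((posGraphs m ⌈(m : ℝ) ^ (1 / 4 : ℝ)⌉₊).filter
              (fun x => φ.2 (fun j => decide (EvalCNF (C j) x)) = true ∧ ¬ EvalDNF dnf x)) : ℝ)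
            ≤ (1 / (8 * (m : ℝ) ^ (c + 1))) * #(posGraphs m ⌈(m : ℝ) ^ (1 / 4 : ℝ)⌉₊) ∧
          (#((((powersetCard (Fintype.card ((⊤ : SimpleGraph (Fin m)).edgeSet) / ⌊(m : ℝ) ^ (1 / 8 : ℝ)⌋₊)
          (univ : Finset ((⊤ : SimpleGraph (Fin m)).edgeSet))).image (fun M => fun e => decide (e ∉ M)))).filter
              (fun x => EvalCNF cnf x ∧ φ.2 (fun j => decide (EvalCNF (C j) x)) = false)) : ℝ)
            ≤ (1 / (8 * (m : ℝ) ^ (c + 1))) *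
              #(((powersetCard (Fintype.card ((⊤ : SimpleGraph (Fin m)).edgeSet) / ⌊(m : ℝ) ^ (1 / 8 : ℝ)⌋₊)
          (univ : Finset ((⊤ : SimpleGraph (Fin m)).edgeSet))).image (fun M => fun e => decide (e ∉ M))))) ↔
    (∀ c : ℕ, ∃ r₀ s₀ : ℕ, 2 ≤ r₀ ∧ 2 ≤ s₀ ∧ ∀ r s : ℕ, r₀ ≤ r → s₀ ≤ s →
    ∀ᶠ m : ℕ in atTop, ∀ (p : ℕ) (_ : Fact p.Prime) (n d θ : ℕ), d ≤ m ^ c →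
      ∀ (K₀ : Matrix (Fin d) (Fin d) (AlgebraicClosure (ZMod p)))
        (K : Fin n → Matrix (Fin d) (Fin d) (AlgebraicClosure (ZMod p))),
      ¬ (IsPermGate ⌊(m : ℝ) ^ (1 / 16 : ℝ)⌋₊ ⟨n, fun v => decide (θ ≤ (symbolicMatrix K₀ K v).rank)⟩ ∨
          IsGRankGate ⌊(m : ℝ) ^ (1 / 16 : ℝ)⌋₊ ⟨n, fun v => decide (θ ≤ (symbolicMatrix K₀ K v).rank)⟩) →
      ∀ C : Fin n → Finset (Finset ((⊤ : SimpleGraph (Fin m)).edgeSet)),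
        #(univ.image C) ≤ m ^ (c + 3) → (∀ j, ∀ S ∈ C j, #S ≤ s - 1) →
        ∃ dnf cnf : Finset (Finset ((⊤ : SimpleGraph (Fin m)).edgeSet)),
          (∀ R ∈ dnf, #R ≤ r - 1) ∧ (∀ S ∈ cnf, #S ≤ s - 1) ∧
          (∀ x, EvalDNF dnf x → EvalCNF cnf x) ∧
          (#((posGraphs m ⌈(m : ℝ) ^ (1 / 4 : ℝ)⌉₊).filter
              (fun x => decide (θ ≤ (symbolicMatrix K₀ K (fun j => decide (EvalCNF (C j) x))).rank) = true ∧
                ¬ EvalDNF dnf x)) : ℝ)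
            ≤ (1 / (8 * (m : ℝ) ^ (c + 1))) * #(posGraphs m ⌈(m : ℝ) ^ (1 / 4 : ℝ)⌉₊) ∧
          (#((((powersetCard (Fintype.card ((⊤ : SimpleGraph (Fin m)).edgeSet) / ⌊(m : ℝ) ^ (1 / 8 : ℝ)⌋₊)
          (univ : Finset ((⊤ : SimpleGraph (Fin m)).edgeSet))).image (fun M => fun e => decide (e ∉ M)))).filter
              (fun x => EvalCNF cnf x ∧
                decide (θ ≤ (symbolicMatrix K₀ K (fun j => decide (EvalCNF (C j) x))).rank) = false)) : ℝ)
            ≤ (1 / (8 * (m : ℝ) ^ (c + 1))) *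
              #(((powersetCard (Fintype.card ((⊤ : SimpleGraph (Fin m)).edgeSet) / ⌊(m : ℝ) ^ (1 / 8 : ℝ)⌋₊)
          (univ : Finset ((⊤ : SimpleGraph (Fin m)).edgeSet))).image (fun M => fun e => decide (e ∉ M))))) := by
  refine forall_congr' fun c => exists_congr fun r₀ => exists_congr fun s₀ => and_congr_right fun _ =>
    and_congr_right fun _ => forall_congr' fun r => forall_congr' fun s => imp_congr_right fun _ =>
    imp_congr_right fun _ => Filter.eventually_congr (Filter.Eventually.of_forall fun m => ?_)
  exact forall_isGRankGate_iff

end Summit.PneNP.PneNP.Theorems.CliqueExtLowerBound.GRankPrimeFieldLeaf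

end
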